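import Summits.QuantumFields.BalabanUV.T4Continuum.Support.AveragingDeficitMultiLevelFermat
import Summits.QuantumFields.BalabanUV.T4Continuum.Support.MinimalActionLevels

/-!
# AveragingDeficitMultiLevelBridge (T⁴ programme, node NE3, row NE3-R2, gen 3) — DICTIONARY between row NE3-R2's
# multi-level objects (`cavg`, `cavgIter`, `tower`) and the tree's / row NE3's (`B7Prop2Explicit.rescale`, `avgIter` (43),
# `MinimalActionLevels`), and R0 + R2ᴱ restated with the `k`-fold average `avgIter` of the tree

HONEST FRAMING (cell `pub-balaban`, T4-DAG PAGE 1; unit `b2b-balaban-t4-ne3r2-p1` = owner of BINDER-OWNERS row NE3-R2,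
gen 3).  NOT infinite volume, NO mass gap, NOT Clay, NOT summit progress; NE3 NOT proved.  Row NE3-R2 (gen 3) proved R0
and R2ᴱ for honest `(j+2)`-level composite-constraint minimisers (`AveragingDeficitMultiLevelFermat.dualResidual_multiLevel`)
with the constraint written through this row's iterated average `cavgIter` (inner recursion `cavgIter (i+1) W =
cavgIter i (cavg W)`); row NE3's «action sandwich» series (`MinimalActionLevels`, same day) and the tree's B7 module use
`rescale L (bavg L U)` and the outer-recursive `k`-fold average `avgIter` (43).  THIS FILE identifies them, all [folklore],
0 sorry: `cavg_eq_rescale_bavg` (`cavg L U = rescale L (bavg L U)`, `rfl`), `cavgIter_eq_avgIter` (`cavgIter L k U =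
avgIter L U k`, by the tree-side composition law `MinimalActionLevels.avgIter_rescale_bavg` BY NAME), `tower_eq`
(`tower L M′ j = M′·L^j`), `prop1Radius_eq_avgRadius`; and restates the two headline theorems with the tree's `avgIter`:
**`fineCritical_avgIter`**, **`dualResidual_avgIter`** (constraint `avgIter L U (j+2) = avgIter L V (j+2)` = «same
`(j+2)`-fold average (43)», the admissibility notion of B11 §E / row NE3); `fineAction_flat`, `exists_levelSmall` and
**`multiLevel_hypotheses_flat`** (NON-VACUITY: the flat configuration is a periodic `U(N)` `(j+2)`-level constrained minimiser
in the class `a = 0 < b`, `LevelSmall (j+1) b` — by `MinimalActionLevels.fineAction_nonneg` BY NAME).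
CITATION HEADER: no printed sentence is a hypothesis; context: T. Bałaban, Commun. Math. Phys. **98** (1985) 17–51
[Balaban1985Averaging] ((42)–(43) pp. 23–24); **102** (1985) 277–309 [Balaban1985Variational] (§E (115)–(121) p. 295).
PLACEMENT: `Summits/QuantumFields/BalabanUV/` (human rule 2026-08-19).  Record: HOME `t4/T4-EST-NE3-R2.md` v0.4.
-/

set_option autoImplicit false

open scoped BigOperators Matrix Matrix.Norms.L2Operator Topology
open NormedSpace Finset Filter

namespace Summit.QuantumFields.BalabanUV.T4Continuum.AveragingDeficitMultiLevelBridge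

open Literature.MathematicalPhysics.QuantumFieldTheory.Balaban1983to89
open B7Prop1Explicit B7Prop2Explicit MatrixLog UnitaryModel
open T4AveragingDeficitWall hiding Site Plane Plaq Bond
open T4AveragingDeficitWallBoundary (IsPeriodicCfg periodBox)
open AveragingDeficitPeriodicCounting AveragingDeficitDerivWallProof AveragingDeficitResidualPairing
open AveragingDeficitDualResidual AveragingDeficitTorusChart AveragingDeficitChartCalculus AveragingDeficitFermat
open AveragingDeficitTwoLevelPrep AveragingDeficitTwoLevelFermat AveragingDeficitMultiLevelPrep AveragingDeficitMultiLevelFermat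
open MinimalActionLevels (avgIter_rescale_bavg avgRadius)

noncomputable section

variable {d : ℕ} {n : Type*} [Fintype n] [DecidableEq n]

local notation "𝕄" => Matrix n n ℂ
local notation "Site" => B7Prop1Explicit.Site

/-- Row NE3-R2's coarse-unit-lattice average IS the tree's rescaled average: `cavg L U = rescale L (bavg L U)`. [cite: Balaban1985Averaging, (42)–(43) pp.23–24] -/
theorem cavg_eq_rescale_bavg (L : ℕ) (U : Site d → Fin d → 𝕄ˣ) : cavg L U = rescale L (bavg L U) := rfl

/-- Row NE3-R2's iterated average IS the tree's `k`-fold average (43): `cavgIter L k U = avgIter L U k` (inner vs outer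
recursion; the tree-side composition law `avgIter_rescale_bavg` BY NAME). [cite: Balaban1985Averaging, (43) p.24] -/
theorem cavgIter_eq_avgIter (L : ℕ) : ∀ (k : ℕ) (U : Site d → Fin d → 𝕄ˣ), cavgIter L k U = avgIter L U k
  | 0, _ => rfl
  | k + 1, U => by
      show cavgIter L k (cavg L U) = avgIter L U (k + 1)
      rw [cavgIter_eq_avgIter L k, cavg_eq_rescale_bavg, avgIter_rescale_bavg]

omit [Fintype n] [DecidableEq n] in
/-- The tower of periods in the «`N·L^k`» form of `MinimalActionLevels`: `tower L M′ j = M′·L^j`. [folklore] -/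
theorem tower_eq (L M' : ℕ) : ∀ j : ℕ, tower L M' j = M' * L ^ j
  | 0 => by simp [tower]
  | j + 1 => by rw [show tower L M' (j + 1) = L * tower L M' j from rfl, tower_eq L M' j]; ring

omit [Fintype n] [DecidableEq n] in
/-- The two rows' names for B7 Prop. 1's output radius agree: `prop1Radius d L a = avgRadius d L a`. [folklore] -/
theorem prop1Radius_eq_avgRadius (L : ℕ) (a : ℝ) : prop1Radius d L a = avgRadius d L a := by
  unfold prop1Radius avgRadius
  ring

/-- **R0 with the tree's `k`-fold average**: `fineCritical_multiLevel` for the composite constraint written as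
`avgIter L U (j+2) = avgIter L V (j+2)` («same `(j+2)`-fold average (43)»). [cite: Balaban1985Variational, (115)–(121) p.295] -/
theorem fineCritical_avgIter [Nonempty n] {L M' : ℕ} [NeZero L] [NeZero M'] (j : ℕ) {V : Site d → Fin d → 𝕄ˣ}
    (hV : IsUnitaryCfg V) (hVP : IsPeriodicCfg V ((L : ℤ) * (L * tower L M' j : ℕ))) {a b : ℝ} (ha : 0 ≤ a)
    (hab : a < b) (hb : LevelSmall d L (j + 1) b) (hVa : SmallField V a)
    (hmin : ∀ U : Site d → Fin d → 𝕄ˣ, IsUnitaryCfg U → IsPeriodicCfg U ((L : ℤ) * (L * tower L M' j : ℕ)) →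
      SmallField U b → avgIter L U (j + 2) = avgIter L V (j + 2) →
        fineAction V (blockWindow L (periodBox (L * tower L M' j))).2
          ≤ fineAction U (blockWindow L (periodBox (L * tower L M' j))).2) :
    FineCritical L (L * tower L M' j) V (fun φ => levelQ' L M' j (cavg L V) (resDir (L * tower L M' j) φ) = 0) :=
  fineCritical_multiLevel j hV hVP ha hab hb hVa fun U hU hUP hUb hUeq =>
    hmin U hU hUP hUb (by rw [← cavgIter_eq_avgIter, ← cavgIter_eq_avgIter]; exact hUeq)

/-- **R2ᴱ ON THE TORUS with the tree's `k`-fold average**: `dualResidual_multiLevel` for the composite constraint written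
as `avgIter L U (j+2) = avgIter L V (j+2)`: for every periodic coarse `𝔲(N)` direction `φ` with `TangentIter L j (cavg L V) φ`,
`L^{d−4}|⟨J(V̄), φ⟩| ≤ wallConst·[‖∇_VF‖_{ℓ²(period)}·dualC2·‖φ‖_{ℓ²} + a²·dualC1·‖φ‖_{ℓ¹}]`.
[cite: Balaban1985Variational, (26)–(27) p.282, §E (115)–(121) p.295] -/
theorem dualResidual_avgIter [Nonempty n] {L M' : ℕ} [NeZero L] [NeZero M'] (j : ℕ) {V : Site d → Fin d → 𝕄ˣ}
    (hV : IsUnitaryCfg V) (hVP : IsPeriodicCfg V ((L : ℤ) * (L * tower L M' j : ℕ))) {a b : ℝ} (ha : 0 ≤ a)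
    (hab : a < b) (hb : LevelSmall d L (j + 1) b) (hVa : SmallField V a)
    (hmin : ∀ U : Site d → Fin d → 𝕄ˣ, IsUnitaryCfg U → IsPeriodicCfg U ((L : ℤ) * (L * tower L M' j : ℕ)) →
      SmallField U b → avgIter L U (j + 2) = avgIter L V (j + 2) →
        fineAction V (blockWindow L (periodBox (L * tower L M' j))).2
          ≤ fineAction U (blockWindow L (periodBox (L * tower L M' j))).2)
    (φ : Site d → Fin d → 𝕄) (hφs : ∀ (y : Site d) (κ : Fin d), φ y κ ∈ skewAdjoint 𝕄)
    (hφP : ∀ (y : Site d) (i κ : Fin d), φ (y + ((L * tower L M' j : ℕ) : ℤ) • e i) κ = φ y κ)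
    (hφT : TangentIter L j (cavg L V) φ)
    (Φ : Site d → Fin d → 𝕄) (hΦ : ∀ (y : Site d) (κ : Fin d), Φ ((L : ℤ) • y) κ = φ y κ) {Dc : ℝ}
    (hDc : HasDerivAt
      (fun s : ℝ => coarseActionOf L (vary (bavg L V) Φ s) (blockWindow L (periodBox (L * tower L M' j))).1) Dc 0) :
    (L : ℝ) ^ ((d : ℤ) - 4) * |Dc|
      ≤ wallConst d L * (Real.sqrt (gradFluxSq V (blockSites L (periodBox (L * tower L M' j))))
            * (dualC2 d L * Real.sqrt (coarseSq (L * tower L M' j) φ))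
          + a ^ 2 * (dualC1 d L * coarseL1 (L * tower L M' j) φ)) :=
  dualResidual_multiLevel j hV hVP ha hab hb hVa (fun U hU hUP hUb hUeq =>
    hmin U hU hUP hUb (by rw [← cavgIter_eq_avgIter, ← cavgIter_eq_avgIter]; exact hUeq)) φ hφs hφP hφT Φ hΦ hDc

/-- The fine Wilson action of the flat configuration vanishes. [folklore] -/
theorem fineAction_flat [Nonempty n] (W : Finset (T4AveragingDeficitWall.Plaq d)) :
    fineAction (fun (_ : Site d) (_ : Fin d) => (1 : 𝕄ˣ)) W = 0 := by
  unfold fineAction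
  refine Finset.sum_eq_zero fun p _ => ?_
  rw [fhol, hol_flat, wt_one]

omit [Fintype n] [DecidableEq n] in
/-- A radius satisfying the multi-level smallness exists (e.g. `(twoLevelSmall·(2L²)^k)⁻¹`). [folklore] -/
theorem exists_levelSmall (L : ℕ) [NeZero L] (k : ℕ) : ∃ b : ℝ, 0 < b ∧ LevelSmall d L k b := by
  have hL : 1 ≤ L := Nat.one_le_iff_ne_zero.mpr (NeZero.ne L)
  have hL1 : (1 : ℝ) ≤ L := by exact_mod_cast hL
  have hc : 0 < twoLevelSmall d L * (2 * (L : ℝ) ^ 2) ^ k := by unfold twoLevelSmall; positivity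
  refine ⟨(twoLevelSmall d L * (2 * (L : ℝ) ^ 2) ^ k)⁻¹, inv_pos.mpr hc, levelSmall_of_pow hL k (inv_pos.mpr hc).le ?_⟩
  rw [mul_inv_cancel₀ hc.ne']

/-- **NON-VACUITY OF THE HYPOTHESES of `fineCritical_multiLevel` / `dualResidual_multiLevel` / `dualResidual_avgIter`**:
the FLAT configuration is a `U(N)`-valued periodic `(j+2)`-level constrained minimiser in the small-field class
`a = 0 < b` with `LevelSmall (j+1) b` — every competitor has non-negative fine action (`MinimalActionLevels.fineAction_nonneg`)
and the flat one has action `0`.  So the theorems quantify over a non-empty class (and for the flat datum their conclusion is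
the flat case of gen 2's `fineCritical_flat`). [folklore] -/
theorem multiLevel_hypotheses_flat [Nonempty n] {L M' : ℕ} [NeZero L] [NeZero M'] (j : ℕ) :
    ∃ b : ℝ, 0 < b ∧ LevelSmall d L (j + 1) b
      ∧ IsUnitaryCfg (fun (_ : Site d) (_ : Fin d) => (1 : 𝕄ˣ))
      ∧ IsPeriodicCfg (fun (_ : Site d) (_ : Fin d) => (1 : 𝕄ˣ)) ((L : ℤ) * (L * tower L M' j : ℕ))
      ∧ SmallField (fun (_ : Site d) (_ : Fin d) => (1 : 𝕄ˣ)) 0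
      ∧ (∀ U : Site d → Fin d → 𝕄ˣ, IsUnitaryCfg U → IsPeriodicCfg U ((L : ℤ) * (L * tower L M' j : ℕ)) →
          SmallField U b → avgIter L U (j + 2) = avgIter L (fun (_ : Site d) (_ : Fin d) => (1 : 𝕄ˣ)) (j + 2) →
            fineAction (fun (_ : Site d) (_ : Fin d) => (1 : 𝕄ˣ)) (blockWindow L (periodBox (L * tower L M' j))).2
              ≤ fineAction U (blockWindow L (periodBox (L * tower L M' j))).2) := by
  obtain ⟨b, hb0, hb⟩ := exists_levelSmall (d := d) L (j + 1)
  obtain ⟨hu, hs⟩ := flat_mem_classes (d := d) (n := n) (a := 0) le_rfl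
  refine ⟨b, hb0, hb, hu, fun _ _ _ => rfl, hs, fun U hU _ _ _ => ?_⟩
  rw [fineAction_flat]
  exact MinimalActionLevels.fineAction_nonneg hU _

end

end Summit.QuantumFields.BalabanUV.T4Continuum.AveragingDeficitMultiLevelBridge
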